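import Literature.AlgebraicGeometry.Frobenioids.ArithmeticDivisorsDegreeTransport
import Literature.AlgebraicGeometry.Frobenioids.ArithmeticDivisorsMonoidIsoPlaces
import Literature.AlgebraicGeometry.Frobenioids.MotivatingExamplesThm64ivDegOne
import Literature.AlgebraicGeometry.Frobenioids.ArithmeticFrobenioidStandard
import Literature.AlgebraicGeometry.Frobenioids.ArithmeticFrobenioidIsotropic
import Literature.AlgebraicGeometry.Frobenioids.ArithmeticFrobenioidsProofs
import Literature.AlgebraicGeometry.Frobenioids.Cor54SubBiratCompatProofs
import Literature.AlgebraicGeometry.Frobenioids.ModelFrobenioidBirat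
import Literature.AlgebraicGeometry.Frobenioids.EquivalencePreStepsQuasiIsotropic
import Literature.AlgebraicGeometry.Frobenioids.FinSubextCatFSM
import Literature.AlgebraicGeometry.Frobenioids.DivisorMonoidCategoryTheoreticity
import HarnessLib

/-!
# Frobenioids I, Theorem 6.4 (iv) AT THE CONSTRUCTIONS, realification-free: an equivalence of arithmetic
# Frobenioids PRESERVES THE NORMS OF PRIMES, hence identifies the (Galois over `ℚ`) fields of corresponding
# base objects

Mochizuki, *The geometry of Frobenioids I: the general theory*, Kyushu J. Math. **62** (2008) 293–400, §6,
Thm. 6.4 (iv) p. 115 l. 17–29 and its proof p. 116 l. 17–35 ("`deg^arith_{L_i}` maps a generator of the monoid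
`Φ_i(L_i)_{v_i} (≅ ℤ_{≥0})` to `log(p)`. Thus, we conclude that `deg(Φ^rlf) = 1` … hence that `L₁ = L₂`"), with
Thm. 6.4 (i)–(ii) p. 115 l. 27 – p. 116 l. 3 (Dirichlet; "arises from an isomorphism of monoids") and Cor. 5.4
p. 104 ("Corollary 5.4 follows immediately from Corollaries 4.10; 4.11, (iii), (iv)", the `Φ^birat` part)
[cite: MochizukiFrdI2008, Thm. 6.4 (iv) p.115].

PROOF-ONLY file (cell abc-iut, `plan/L1/SUBDAG-FrdI-Thm64.md` §G rows T64iv/L01 + the DATA-LEVEL composition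
T64iv/L08, piece «G-A»; L1-lead R108 (4) row (G); seat abc-iut-L1-d7).  At THE arithmetic Frobenioids
`C_{K/F} = arithFrobenioid F K` (operations `arithFrobenioidOps F K`), for an equivalence `Ψ : C_{K₁/F₁} ⥲ C_{K₂/F₂}`
and the DATUM of [FrdI] Cor. 4.11 (iv) for `Ψ` — `Ψ^Base` (an equivalence), `Ψ^Φ = E` over it, `η : Base₂ ∘ Ψ ≅
Ψ^Base ∘ Base₁`, and `Div(Ψ φ) = η^* Ψ^Φ(Div φ)` (explicit binders; the typed conclusion shape of abc-iut-L1-t3's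
`PreFrobenioidData.Cor411iv`, delivered at `C_{K/F}` by abc-iut-L1-t14's `FrdI.exists_cor411iv_data_ofFunctor_of_isOfFSMType`
/ packaged by `exists_transport_of_cor411iv`):
* `arith_thm34ii_preserves` — [FrdI] Thm. 3.4 (ii) for EVERY such `Ψ` (bases `FinSubextCat F K` of FSM-type,
  `C_{K/F}` isotropic hence quasi-isotropic; abc-iut-L1-t13's `FrdI.thm34ii_of_isOfFSMType`);
* `arith_biratCompat_of_cor411iv` — `Ψ^Φ` carries `Φ₁^birat(X) = div(L₁^×)` ONTO `Φ₂^birat(Ψ^Base X)` (row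
  C54/L03 at `C_{K/F}`: abc-iut-w5-d097/w5-d137's `FrdI.Cor54Sub.biratCompat_of`);
* **`arith_exists_logNorm_eq_mul`** / **`arith_logNorm_transport`** — for the generator-to-generator bijection
  `π_X` of finite places (`Ψ^Φ_X δ_w = δ_{π_X w}`, row T64iv/L01): `log N(π_X w) = log N(w)` for every finite
  `w`.  Proof: the groupified `(Ψ^Φ_X)^gp : Φ(L₁)^gp → Φ(L₂)^gp` restricts to the effective divisors and carries
  principal divisors to principal divisors (the `Φ^birat` clause + abc-iut-L1-t2's `Φ^birat = Div_B(B)` for model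
  Frobenioids), so it multiplies `deg^arith` by ONE constant `c > 0` (`ArithmeticDivisorsDegreeTransport.lean`:
  Dirichlet + class group), `log N(π w) = c · log N(w)`; and `c = 1` by `Thm64iv_of_logNorm_transport` (Thm. 6.4
  (iii) at `q = 1` + a completely split prime);
* **`Thm64iv_arith_fieldIso`** — hence, for `X = Spec L₁` with `L₁` Galois over `ℚ`, `L₁ ≅ L₂ := (Ψ^Base X).L` as
  fields: [FrdI] Thm. 6.4 (iv), second clause, AT THE CONSTRUCTIONS, from the Cor. 4.11 (iv) datum alone — no
  realification / (ii) / (iii) premise.  (The compatibility with an isomorphism `F₁ ≅ F₂` asserted in print,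
  row T64iv/L07b, is abc-iut-L1-d4's `Thm64iv_compat_of_transport_of_isGalois_base` / GAP-LEDGER G-L1t3-1 and
  is not claimed here; the first clause "`deg(Ψ^rlf) = 1`" for THE `Ψ^rlf` of (ii) then needs only the degree
  relation at ONE generator class — the T64ii assembly, abc-iut-L1-t3's row.)
No definitions, no named facts; nothing here bears on [IUTchIII] Cor. 3.12 or asserts anything about abc.
-/

noncomputable section

namespace Literature.AlgebraicGeometry.Frobenioids

open CategoryTheory Opposite NumberField

section Arith

variable {F₁ : Type} [Field F₁] [NumberField F₁] {K₁ : Type} [Field K₁] [Algebra F₁ K₁] [IsGalois F₁ K₁]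
variable {F₂ : Type} [Field F₂] [NumberField F₂] {K₂ : Type} [Field K₂] [Algebra F₂ K₂] [IsGalois F₂ K₂]

/-! ### Thm. 3.4 (ii) and the birational compatibility at `C_{K/F}` -/

/-- **[FrdI] Thm. 3.4 (ii) holds for every equivalence `Ψ : C_{K₁/F₁} ⥲ C_{K₂/F₂}` of arithmetic Frobenioids**:
`Ψ` preserves pre-steps, co-angular pre-steps and group-like objects (the `C_{K/F}` are of isotropic, hence
quasi-isotropic, type and the bases `D = B(Gal(K/F))⁰` are of FSM-type — Thm. 6.4 (i) / Thm. 6.2 (iii) proof).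
[cite: MochizukiFrdI2008, Thm. 6.4 (iv) p.115] -/
theorem arith_thm34ii_preserves (Ψ : arithFrobenioid F₁ K₁ ≌ arithFrobenioid F₂ K₂) :
    PreFrobenioidData.PreservesMor Ψ.functor (arithFrobenioidOps F₁ K₁).IsPreStep
        (arithFrobenioidOps F₂ K₂).IsPreStep ∧
      PreFrobenioidData.PreservesMor Ψ.functor (arithFrobenioidOps F₁ K₁).IsCoAngularPreStep
        (arithFrobenioidOps F₂ K₂).IsCoAngularPreStep ∧
      PreFrobenioidData.PreservesObj Ψ.functor (arithFrobenioidOps F₁ K₁).IsGroupLikeObj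
        (arithFrobenioidOps F₂ K₂).IsGroupLikeObj :=
  FrdI.thm34ii_of_isOfFSMType (arithFrobenioid_isFrobenioid F₁ K₁) (arithFrobenioid_isFrobenioid F₂ K₂)
    (isOfStandardType_arith F₁ K₁).quasiIsotropic (isOfStandardType_arith F₂ K₂).quasiIsotropic
    (FinSubextCat.isOfFSMType F₁ K₁) (FinSubextCat.isOfFSMType F₂ K₂) Ψ

/-- **Row C54/L03 at `C_{K/F}` from the Cor. 4.11 (iv) datum**: `Ψ^Φ` carries `Φ₁^birat(X) = div(L₁^×)` ONTO
`Φ₂^birat(Ψ^Base X)` for every `X` (`FrdI.Cor54Sub.biratCompat_of`, fed with Thm. 3.4 (ii) for `Ψ` and `Ψ⁻¹`).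
[cite: MochizukiFrdI2008, Cor. 5.4 p.104] -/
theorem arith_biratCompat_of_cor411iv (Ψ : arithFrobenioid F₁ K₁ ≌ arithFrobenioid F₂ K₂)
    {ΨBase : FinSubextCat F₁ K₁ ⥤ FinSubextCat F₂ K₂} [ΨBase.IsEquivalence]
    (E : PreFrobenioidData.DivisorMonoidIsoOverBase (arithFrobenioidOps F₁ K₁) (arithFrobenioidOps F₂ K₂) ΨBase)
    (η : Ψ.functor ⋙ (arithFrobenioidOps F₂ K₂).base ≅ (arithFrobenioidOps F₁ K₁).base ⋙ ΨBase)
    (hdiv : ∀ ⦃A B : arithFrobenioid F₁ K₁⦄ (φ : A ⟶ B),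
      (arithFrobenioidOps F₂ K₂).div (Ψ.functor.map φ) =
        (arithFrobenioidOps F₂ K₂).pull (η.hom.app A)
          (E.iso ((arithFrobenioidOps F₁ K₁).base.obj A) ((arithFrobenioidOps F₁ K₁).div φ))) :
    FrdI.Cor54Sub.BiratCompat
      (ModelFrobenioid.toElem (arithDivisorFunctor F₁ K₁) (unitsFunctor F₁ K₁) (divNatTrans F₁ K₁))
      (ModelFrobenioid.toElem (arithDivisorFunctor F₂ K₂) (unitsFunctor F₂ K₂) (divNatTrans F₂ K₂)) ΨBase E := by
  obtain ⟨hpre, hco, -⟩ := arith_thm34ii_preserves Ψ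
  obtain ⟨hpre', hco', -⟩ := arith_thm34ii_preserves Ψ.symm
  exact FrdI.Cor54Sub.biratCompat_of
    (ModelFrobenioid.toElem (arithDivisorFunctor F₁ K₁) (unitsFunctor F₁ K₁) (divNatTrans F₁ K₁))
    (ModelFrobenioid.toElem (arithDivisorFunctor F₂ K₂) (unitsFunctor F₂ K₂) (divNatTrans F₂ K₂))
    Ψ (arithFrobenioid_isFrobenioid F₂ K₂).isPreFrobenioid ΨBase E η hdiv hpre hco hpre' hco'

/-! ### The divisor component of the datum at one base object, groupified -/

omit [IsGalois F₁ K₁] [IsGalois F₂ K₂] in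
/-- `Div_B` of `C_{K/F}` at `X = Spec L` is `u ↦ div(u)` read in `Φ(L)^gp` through `Φ(L)^gp ≅ ⊕_v ord(L_v)`.
[cite: MochizukiFrdI2008, Ex. 6.3 p.113] -/
theorem arith_divB_eq (X : FinSubextCat F₁ K₁) (u : (X.L)ˣ) :
    divB (arithDivisorFunctor F₁ K₁) (unitsFunctor F₁ K₁) (divNatTrans F₁ K₁) (op X) u =
      (EffArithDivisor.gpEquiv X.L).symm (Multiplicative.ofAdd (principalArithDivisor X.L u)) := rfl

omit [IsGalois F₁ K₁] [IsGalois F₂ K₂] in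
/-- `Φ(L)^gp ≅ ⊕_v ord(L_v)` sends the class of an effective divisor to itself. [cite: MochizukiFrdI2008, Ex. 6.3 p.113] -/
theorem gpEquiv_symm_toArithDivisor (L : Type) [Field L] [NumberField L] (D : EffArithDivisor L) :
    (EffArithDivisor.gpEquiv L).symm (Multiplicative.ofAdd (EffArithDivisor.toArithDivisor L D)) =
      Algebra.GrothendieckGroup.of (Multiplicative.ofAdd D) := by
  rw [MulEquiv.symm_apply_eq, EffArithDivisor.gpEquiv_apply, EffArithDivisor.gpHom_of, toAdd_ofAdd]

/-- **The norms of primes are rescaled by ONE positive constant** along the generator-to-generator bijection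
`π_X` of an equivalence `Ψ` with Cor. 4.11 (iv) datum `(Ψ^Base, Ψ^Φ, η)`: `log N(π_X w) = c · log N(w)` for all
finite `w` of `L₁ = X.L` — `(Ψ^Φ_X)^gp` restricts to `Φ` and carries principal divisors to principal divisors,
so `ArithmeticDivisorsDegreeTransport.exists_logNorm_eq_mul_of_transport` applies.
[cite: MochizukiFrdI2008, Thm. 6.4 (iv) p.116] -/
theorem arith_exists_logNorm_eq_mul (Ψ : arithFrobenioid F₁ K₁ ≌ arithFrobenioid F₂ K₂)
    {ΨBase : FinSubextCat F₁ K₁ ⥤ FinSubextCat F₂ K₂} [ΨBase.IsEquivalence]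
    (E : PreFrobenioidData.DivisorMonoidIsoOverBase (arithFrobenioidOps F₁ K₁) (arithFrobenioidOps F₂ K₂) ΨBase)
    (η : Ψ.functor ⋙ (arithFrobenioidOps F₂ K₂).base ≅ (arithFrobenioidOps F₁ K₁).base ⋙ ΨBase)
    (hdiv : ∀ ⦃A B : arithFrobenioid F₁ K₁⦄ (φ : A ⟶ B),
      (arithFrobenioidOps F₂ K₂).div (Ψ.functor.map φ) =
        (arithFrobenioidOps F₂ K₂).pull (η.hom.app A)
          (E.iso ((arithFrobenioidOps F₁ K₁).base.obj A) ((arithFrobenioidOps F₁ K₁).div φ)))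
    (X : FinSubextCat F₁ K₁) (π : FinitePlace X.L → FinitePlace (ΨBase.obj X).L)
    (hπ : ∀ w : FinitePlace X.L,
      E.iso X (Multiplicative.ofAdd (EffArithDivisor.single X.L (Sum.inr w))) =
        Multiplicative.ofAdd (EffArithDivisor.single (ΨBase.obj X).L (Sum.inr (π w)))) :
    ∃ c : ℝ, 0 < c ∧ ∀ w, logNorm (π w) = c * logNorm w := by
  -- the effective-level and groupified forms of `Ψ^Φ_X`
  let e : Multiplicative (EffArithDivisor X.L) ≃* Multiplicative (EffArithDivisor (ΨBase.obj X).L) := E.iso X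
  let eE : EffArithDivisor X.L →+ EffArithDivisor (ΨBase.obj X).L :=
    AddMonoidHom.toMultiplicative.symm e.toMonoidHom
  let eG : ArithDivisor X.L →+ ArithDivisor (ΨBase.obj X).L :=
    AddMonoidHom.toMultiplicative.symm
      ((EffArithDivisor.gpEquiv (ΨBase.obj X).L).toMonoidHom.comp
        ((MonGp.map e.toMonoidHom).comp (EffArithDivisor.gpEquiv X.L).symm.toMonoidHom))
  have heG_apply : ∀ d : ArithDivisor X.L, eG d = Multiplicative.toAdd
      (EffArithDivisor.gpEquiv (ΨBase.obj X).L (MonGp.map e.toMonoidHom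
        ((EffArithDivisor.gpEquiv X.L).symm (Multiplicative.ofAdd d)))) := fun d => rfl
  have heE_apply : ∀ D : EffArithDivisor X.L, eE D = Multiplicative.toAdd (e (Multiplicative.ofAdd D)) :=
    fun D => rfl
  -- `eG` restricts to `eE` along `Φ ⊆ Φ^gp`
  have heG : ∀ D, eG (EffArithDivisor.toArithDivisor X.L D) =
      EffArithDivisor.toArithDivisor (ΨBase.obj X).L (eE D) := fun D => by
    rw [heG_apply, gpEquiv_symm_toArithDivisor, MonGp.map_of, EffArithDivisor.gpEquiv_apply,
      EffArithDivisor.gpHom_of, toAdd_ofAdd]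
    rfl
  -- `eG` carries principal divisors to principal divisors (the `Φ^birat` clause of Cor. 5.4)
  have hB₂ : ∀ (A : (FinSubextCat F₂ K₂)ᵒᵖ) (b : (unitsFunctor F₂ K₂).obj A), IsUnit b := fun A b =>
    (unitsFunctor_isGroupLike F₂ K₂ A.unop).isUnit b
  have hBC := arith_biratCompat_of_cor411iv Ψ E η hdiv X
  have hprinc : ∀ u : (X.L)ˣ, ∃ v : ((ΨBase.obj X).L)ˣ,
      eG (principalArithDivisor X.L u) = principalArithDivisor (ΨBase.obj X).L v := fun u => by
    have hmem : MonGp.map e.toMonoidHom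
        (divB (arithDivisorFunctor F₁ K₁) (unitsFunctor F₁ K₁) (divNatTrans F₁ K₁) (op X) u) ∈
          (PreFrobenioid.biratSubfunctor
            (ModelFrobenioid.toElem (arithDivisorFunctor F₂ K₂) (unitsFunctor F₂ K₂) (divNatTrans F₂ K₂))).carrier
            (ΨBase.obj X) := by
      rw [← hBC]
      exact Subgroup.mem_map_of_mem _ (ModelFrobenioid.divB_mem_biratSubfunctor
        (fun A b => (unitsFunctor_isGroupLike F₁ K₁ A.unop).isUnit b) X u)
    rw [ModelFrobenioid.biratSubfunctor_carrier_eq hB₂ (ΨBase.obj X)] at hmem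
    obtain ⟨v, hv⟩ : ∃ v : ((ΨBase.obj X).L)ˣ,
        divB (arithDivisorFunctor F₂ K₂) (unitsFunctor F₂ K₂) (divNatTrans F₂ K₂) (op (ΨBase.obj X)) v =
          MonGp.map e.toMonoidHom
            (divB (arithDivisorFunctor F₁ K₁) (unitsFunctor F₁ K₁) (divNatTrans F₁ K₁) (op X) u) := hmem
    refine ⟨v, ?_⟩
    rw [heG_apply, ← arith_divB_eq, ← hv, arith_divB_eq, MulEquiv.apply_symm_apply, toAdd_ofAdd]
  -- generator ↦ generator at the effective level
  have hπ' : ∀ w : FinitePlace X.L, eE (Finsupp.single w 1, 0) = (Finsupp.single (π w) 1, 0) := fun w => by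
    rw [heE_apply, ← EffArithDivisor.single_inr X.L w]
    change Multiplicative.toAdd (E.iso X (Multiplicative.ofAdd (EffArithDivisor.single X.L (Sum.inr w)))) = _
    rw [hπ]
    rfl
  exact exists_logNorm_eq_mul_of_transport eG eE heG hprinc π hπ'

/-- **An equivalence of arithmetic Frobenioids PRESERVES THE NORMS OF PRIMES** (Thm. 6.4 (iv), proof p. 116
l. 25–27 "`deg^arith_{L_i}` maps a generator of `Φ_i(L_i)_{v_i}` to `log(p)`", made unconditional): along the
generator-to-generator bijection `π_X` of `Ψ` at `X = Spec L₁`, `log N(π_X w) = log N(w)` for EVERY finite place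
`w` — the constant of `arith_exists_logNorm_eq_mul` is `1` by `Thm64iv_of_logNorm_transport` (Thm. 6.4 (iii) at
`q = 1` gives the residue characteristics, a completely split prime gives `c = 1`).
[cite: MochizukiFrdI2008, Thm. 6.4 (iv) p.116] -/
theorem arith_logNorm_transport (Ψ : arithFrobenioid F₁ K₁ ≌ arithFrobenioid F₂ K₂)
    {ΨBase : FinSubextCat F₁ K₁ ⥤ FinSubextCat F₂ K₂} [ΨBase.IsEquivalence]
    (E : PreFrobenioidData.DivisorMonoidIsoOverBase (arithFrobenioidOps F₁ K₁) (arithFrobenioidOps F₂ K₂) ΨBase)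
    (η : Ψ.functor ⋙ (arithFrobenioidOps F₂ K₂).base ≅ (arithFrobenioidOps F₁ K₁).base ⋙ ΨBase)
    (hdiv : ∀ ⦃A B : arithFrobenioid F₁ K₁⦄ (φ : A ⟶ B),
      (arithFrobenioidOps F₂ K₂).div (Ψ.functor.map φ) =
        (arithFrobenioidOps F₂ K₂).pull (η.hom.app A)
          (E.iso ((arithFrobenioidOps F₁ K₁).base.obj A) ((arithFrobenioidOps F₁ K₁).div φ)))
    (X : FinSubextCat F₁ K₁) (π : FinitePlace X.L ≃ FinitePlace (ΨBase.obj X).L)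
    (hπ : ∀ w : FinitePlace X.L,
      E.iso X (Multiplicative.ofAdd (EffArithDivisor.single X.L (Sum.inr w))) =
        Multiplicative.ofAdd (EffArithDivisor.single (ΨBase.obj X).L (Sum.inr (π w))))
    (w : FinitePlace X.L) : logNorm (π w) = logNorm w := by
  obtain ⟨c, hc, hgen⟩ := arith_exists_logNorm_eq_mul Ψ E η hdiv X π hπ
  obtain ⟨hc1, -⟩ := Thm64iv_at_of_logNorm_transport ΨBase X π c hc hgen
  rw [hgen w, hc1, one_mul]

/-- Hence `π_X` preserves residue characteristics (Thm. 6.4 (iii)'s conclusion for `Ψ` itself, at `q = 1`).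
[cite: MochizukiFrdI2008, Thm. 6.4 (iii) p.115] -/
theorem arith_residueChar_transport (Ψ : arithFrobenioid F₁ K₁ ≌ arithFrobenioid F₂ K₂)
    {ΨBase : FinSubextCat F₁ K₁ ⥤ FinSubextCat F₂ K₂} [ΨBase.IsEquivalence]
    (E : PreFrobenioidData.DivisorMonoidIsoOverBase (arithFrobenioidOps F₁ K₁) (arithFrobenioidOps F₂ K₂) ΨBase)
    (η : Ψ.functor ⋙ (arithFrobenioidOps F₂ K₂).base ≅ (arithFrobenioidOps F₁ K₁).base ⋙ ΨBase)
    (hdiv : ∀ ⦃A B : arithFrobenioid F₁ K₁⦄ (φ : A ⟶ B),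
      (arithFrobenioidOps F₂ K₂).div (Ψ.functor.map φ) =
        (arithFrobenioidOps F₂ K₂).pull (η.hom.app A)
          (E.iso ((arithFrobenioidOps F₁ K₁).base.obj A) ((arithFrobenioidOps F₁ K₁).div φ)))
    (X : FinSubextCat F₁ K₁) (π : FinitePlace X.L ≃ FinitePlace (ΨBase.obj X).L)
    (hπ : ∀ w : FinitePlace X.L,
      E.iso X (Multiplicative.ofAdd (EffArithDivisor.single X.L (Sum.inr w))) =
        Multiplicative.ofAdd (EffArithDivisor.single (ΨBase.obj X).L (Sum.inr (π w))))
    (w : FinitePlace X.L) : residueChar (π w) = residueChar w :=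
  residueChar_eq_of_logNorm_transport X.L (ΨBase.obj X).L π 1 one_pos
    (fun w' => by rw [one_mul, arith_logNorm_transport Ψ E η hdiv X π hπ w']) w

/-- **[FrdI] Thm. 6.4 (iv), second clause, AT THE CONSTRUCTIONS — realification-free**: for an equivalence
`Ψ : C_{K₁/F₁} ⥲ C_{K₂/F₂}` of arithmetic Frobenioids with Cor. 4.11 (iv) datum `(Ψ^Base, Ψ^Φ, η)` and an
object `X = Spec L₁` of `D₁` with `L₁` Galois over `ℚ`, the field `L₂` of the corresponding object `Ψ^Base X` of
`D₂` is isomorphic to `L₁` ("the corresponding finite extension `L₂ ⊆ F̃₂` of `F₂` is isomorphic to `L₁`").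
The bijection `π_X` is any generator-to-generator bijection of `Ψ^Φ_X` (it exists and is unique:
`EffArithDivisor.exists_finitePlaceEquiv_mulEquiv` / `finitePlaceEquiv_unique_mulEquiv`).  Print's further
clause "in a fashion that is compatible with an isomorphism `F₁ ≅ F₂`" (row T64iv/L07b) is not claimed here.
[cite: MochizukiFrdI2008, Thm. 6.4 (iv) p.115] -/
theorem Thm64iv_arith_fieldIso (Ψ : arithFrobenioid F₁ K₁ ≌ arithFrobenioid F₂ K₂)
    {ΨBase : FinSubextCat F₁ K₁ ⥤ FinSubextCat F₂ K₂} [ΨBase.IsEquivalence]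
    (E : PreFrobenioidData.DivisorMonoidIsoOverBase (arithFrobenioidOps F₁ K₁) (arithFrobenioidOps F₂ K₂) ΨBase)
    (η : Ψ.functor ⋙ (arithFrobenioidOps F₂ K₂).base ≅ (arithFrobenioidOps F₁ K₁).base ⋙ ΨBase)
    (hdiv : ∀ ⦃A B : arithFrobenioid F₁ K₁⦄ (φ : A ⟶ B),
      (arithFrobenioidOps F₂ K₂).div (Ψ.functor.map φ) =
        (arithFrobenioidOps F₂ K₂).pull (η.hom.app A)
          (E.iso ((arithFrobenioidOps F₁ K₁).base.obj A) ((arithFrobenioidOps F₁ K₁).div φ)))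
    (X : FinSubextCat F₁ K₁) (hX : IsGalois ℚ X.L) : Nonempty (X.L ≃+* (ΨBase.obj X).L) := by
  obtain ⟨π, hπ⟩ := EffArithDivisor.exists_finitePlaceEquiv_mulEquiv (E.iso X)
  obtain ⟨c, hc, hgen⟩ := arith_exists_logNorm_eq_mul Ψ E η hdiv X π hπ
  exact (Thm64iv_at_of_logNorm_transport ΨBase X π c hc hgen).2 hX

end Arith

end Literature.AlgebraicGeometry.Frobenioids

end
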